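import Summits.BirchSwinnertonDyer.Rank1Residual.AdditivePotMult.PStarTwistModel
import Summits.BirchSwinnertonDyer.Rank1Residual.AdditivePotMult.TwistSupplyJ
import Summits.BirchSwinnertonDyer.Rank1Residual.AdditivePotMult.Twist
import Summits.BirchSwinnertonDyer.Rank1Residual.Additive.SharpenedStatements
import Literature.NumberTheory.EllipticCurves.Skinner2016.RankZeroPPart
import HarnessLib

/-!
# Erratum road at `p ≥ 5`, crux `EulerHalfNotRamNoInertSetAtFive` (item 19715): the RAMIFIED-TWIN
# (ram)-transport — a twist ramified at an odd potentially multiplicative additive prime is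
# MULTIPLICATIVE there, with `ord_q Δ_min = −ord_q j`, hence carries the (ram) witness `q`

Cell `bsd-stepL`, line `birth` of crux `stmt-BirchSwinnertonDyer-19715`
(`Theses.ErratumRoadFive.EulerHalfNotRamNoInertSetAtFive`); helper file (`--supports` the crux item)
for the crux idea card `Cruxes/EulerHalfNotRamNoInertSetAtFive/Ideas/ramified-twin-ram-transport.md`
(bsd-idea-9 g14, 2026-08-28), whose FIRST LEMMA `RamTwistOfPotMultRamified` and whose twin lower
half `TwinLowerOfSkinnerC` (Sketch.lean of the card) are proved here as kernel theorems.  Nothing in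
this file closes the crux or any route item; BSD is proved for no curve here.

THE LEVER (card §Lever).  On an S1b pair `(E, p)` (`p ≥ 5` the only multiplicative prime, split,
`p ∣ c_p`, `¬ Ram E p`) every twist by a discriminant UNRAMIFIED at the additive primes of `E` has
`p` as its only multiplicative prime, so its twin is again `¬ Ram` and the line `birth` (v17) must feed
it the open input `X11aLowerHalf` (crux 19064).  If instead `E` has an ODD additive prime `q` of
POTENTIALLY MULTIPLICATIVE reduction (`ord_q j(E) < 0`; Kodaira type `I_m^*`, `m = −ord_q j`) and the
Kolyvagin field is RAMIFIED at `q` (`q ∥ d`), then the twist `E^{(d)}` is MULTIPLICATIVE at `q` with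
`ord_q Δ_min(E^{(d)}) = m`; so whenever `p ∤ m` the twin satisfies Skinner–Urban's hypothesis (ram)
at `p` with witness `q`, and its `≥`-half of BSD_p in analytic rank `0` is Skinner 2016 Thm. C
(tree fact `Skinner2016.thmC_padicValRat_bsd_rank_zero`, row C1) — NOT `X11aLowerHalf`.

CONTENTS (theorems only; no `def`, no named fact introduced; standard axioms).
* §1 `mult_quadraticTwist_of_addv_of_potMult_of_odd` — for `E/ℚ` additive and potentially
  multiplicative at an odd prime `q` and `d ∈ ℚ^×` with `ord_q d` ODD, the twist `E^{(d)}` is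
  multiplicative at `q`.  Proof: the tree's `AdditivePotMult.PotMult.mult_quadraticTwist_pStar`
  (`E^{(q*)}` is multiplicative at `q`, Silverman *ATAEC* V.5.3 via the Tate form of invariant `j`)
  and `E^{(d)} ≅ (E^{(q*)})^{(w)}` with `w = d q^{−2k}/q*` a `q`-adic unit
  (`AdditivePotMult.mult_quadraticTwist_of_padicValRat_eq_zero`: a unit twist at an odd prime
  preserves multiplicative reduction; `quadraticTwist_quadraticTwist`,
  `exists_variableChange_quadraticTwist_mul_sq`).
* §2 `ramTwist_of_addv_of_potMult` — the card's FIRST LEMMA `RamTwistOfPotMultRamified`, with the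
  binders of its Sketch verbatim: for `W` globally minimal, `q ≠ 2`, `q ≠ p`, `Addv W q`,
  `Additive.PotMult W q`, `d ∈ ℤ` with `padicValInt q d = 1`, `Wd = Cd • W^{(d)}` globally minimal and
  `p ∤ ord_q j(W)`:  `Mult Wd q ∧ ord_q Δ_min(Wd) = −ord_q j(W) ∧ Ram Wd p`
  (`ord_q j = −ord_q Δ_min` at a multiplicative prime of a globally minimal model:
  `AdditivePotMult.padicValRat_j_eq_neg_of_mult`; `j(Wd) = j(W)`: `AdditivePotMult.j_of_model_twist`).
  `ramTwistOfPotMultRamified` restates it in the `∀`-form of the Sketch's `def`.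
* §3 `twinLower_of_thmC` — the card's `TwinLowerOfSkinnerC`: from Skinner 2016 Thm. C (named fact,
  taken as a hypothesis — this theorem is CONDITIONAL on it, exactly as the Sketch's `def` is an
  implication from it) and §2, for `p ≥ 5`, `Irr W p`, the twin `Wd` multiplicative at `p` with
  `L(Wd, 1) ≠ 0` and `Ш(Wd)` finite: the `p`-part of the rank-`0` BSD formula of `Wd` in Skinner's
  currency (`∃ r : ℚ, L(Wd,1)/Ω = r ∧ ord_p r = ord_p #Ш + ord_p ∏ c_ℓ − 2 ord_p #Wd(ℚ)_tors`);
  `Irr` passes to the twin by `AdditivePotMult.irr_iff_of_model_twist`.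

References: J. H. Silverman, *Advanced Topics in the Arithmetic of Elliptic Curves*, GTM 151 (1994),
V.5 Lemma 5.1, Thm. 5.3 (an elliptic curve with `|j|_v > 1` is the twist of the Tate curve by the
quadratic character of `K(√γ)/K`, `γ = −c₄/c₆`; multiplicative iff that extension is unramified),
IV.9 Table 4.1 (type `I_m^*`) [SilvermanATAEC1994]; J. H. Silverman, *The Arithmetic of Elliptic
Curves*, 2nd ed. (2009), VII.5 Prop. 5.1(b), Prop. 5.5, X.5 Cor. 5.4 [SilvermanAEC2009]; C. Skinner,
*Multiplicative reduction and the cyclotomic main conjecture for GL₂*, Pacific J. Math. 283 (2016),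
Thm. C [Skinner2016PacificMC]; C. Skinner, E. Urban, Invent. Math. 195 (2014) Thm. 2, hypothesis
(ram) [SkinnerUrban2014]; D. Kohen, A. Pacetti, *On Heegner points for primes of additive reduction
ramifying in the base field*, Trans. AMS (2016) = arXiv:1505.08059 §1 (the `E_q`-transport this
card serves) [KohenPacetti2016].
-/

set_option linter.dupNamespace false

noncomputable section

open scoped Classical

open WeierstrassCurve Literature.NumberTheory.EllipticCurves
  Literature.NumberTheory.EllipticCurves.Rank1Residual
  Summit.BirchSwinnertonDyer.Rank1Residual

namespace Summit.BirchSwinnertonDyer.BirchSwinnertonDyer.Theorems.EulerHalfRamTwist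

/-! ### §1 An odd-valuation twist of a potentially multiplicative additive curve is multiplicative -/

section OddTwist

variable {W : WeierstrassCurve ℚ} [W.IsElliptic] {q : ℕ} [hq : Fact q.Prime]

/-- **A twist RAMIFIED at an odd potentially multiplicative additive prime is multiplicative there.**
Let `E/ℚ` be additive at the odd prime `q` with `ord_q j(E) < 0` (Kodaira type `I_m^*`, a ramified
quadratic twist of a Tate curve) and let `d ∈ ℚ^×` have ODD `q`-adic valuation.  Then `E^{(d)}` has
multiplicative reduction at `q`.  Proof: `E^{(q*)}` is multiplicative at `q` (tree
`AdditivePotMult.PotMult.mult_quadraticTwist_pStar`, Silverman *ATAEC* V.5.3), `ord_q d = 2k + 1`,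
`w := d q^{−2k}/q*` is a `q`-adic unit, `(E^{(q*)})^{(w)} = E^{(d q^{−2k})}` on the nose
(`quadraticTwist_quadraticTwist`) is multiplicative (unit twists at odd primes preserve multiplicative
reduction, `AdditivePotMult.mult_quadraticTwist_of_padicValRat_eq_zero`), and
`E^{(d q^{−2k})} ≅ E^{(d)}` over `ℚ` (`exists_variableChange_quadraticTwist_mul_sq`).
[cite: SilvermanATAEC1994, V.5 Thm. 5.3 with Lemma 5.1] [cite: SilvermanAEC2009, VII.5 Prop. 5.1(b) and X.5 Cor. 5.4] -/
theorem mult_quadraticTwist_of_addv_of_potMult_of_odd (hq2 : q ≠ 2) (hadd : Addv W q)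
    (hpm : padicValRat q W.j < 0) {d : ℚ} (hd0 : d ≠ 0) (hodd : Odd (padicValRat q d)) :
    Mult (W.quadraticTwist d) q := by
  have hPM : AdditivePotMult.PotMult W q := ⟨hadd, hpm⟩
  -- `E^{(q*)}` is multiplicative at `q`
  have hm : Mult (W.quadraticTwist ((-1 : ℚ) ^ (q / 2) * q)) q := hPM.mult_quadraticTwist_pStar hq2
  obtain ⟨k, hk⟩ := hodd
  have hq0 : (q : ℚ) ≠ 0 := Nat.cast_ne_zero.mpr hq.out.ne_zero
  set ps : ℚ := (-1 : ℚ) ^ (q / 2) * q with hps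
  have hps0 : ps ≠ 0 := mul_ne_zero (pow_ne_zero _ (by norm_num)) hq0
  have hpsv : padicValRat q ps = 1 := by
    rw [hps, padicValRat.mul (pow_ne_zero _ (by norm_num)) hq0, padicValRat.pow, padicValRat.neg,
      padicValRat.one, mul_zero, zero_add, padicValRat.self hq.out.one_lt]
  -- `d₁ := d · (q^{-k})²` has `ord_q d₁ = 1`
  set e : ℚ := (q : ℚ) ^ (-k) with he
  have he0 : e ≠ 0 := zpow_ne_zero _ hq0
  set d₁ : ℚ := d * e ^ 2 with hd₁
  have hd10 : d₁ ≠ 0 := mul_ne_zero hd0 (pow_ne_zero _ he0)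
  have hd1v : padicValRat q d₁ = 1 := by
    rw [hd₁, padicValRat.mul hd0 (pow_ne_zero _ he0), padicValRat.pow, he, padicValRat.zpow,
      padicValRat.self hq.out.one_lt, hk]
    push_cast
    ring
  -- `w := d₁ / q*` is a `q`-adic unit and `(E^{(q*)})^{(w)} = E^{(d₁)}`
  set w : ℚ := d₁ / ps with hw
  have hw0 : w ≠ 0 := div_ne_zero hd10 hps0
  have hwv : padicValRat q w = 0 := by
    rw [hw, padicValRat.div hd10 hps0, hpsv, hd1v, sub_self]
  haveI := W.isElliptic_quadraticTwist hps0
  have hm1 : Mult (W.quadraticTwist d₁) q := by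
    have h := AdditivePotMult.mult_quadraticTwist_of_padicValRat_eq_zero hq2 hw0 hwv hm
    rwa [quadraticTwist_quadraticTwist, hw, mul_div_cancel₀ _ hps0] at h
  -- `E^{(d₁)} = C • E^{(d)}`
  haveI := W.isElliptic_quadraticTwist hd0
  obtain ⟨C, hC⟩ := W.exists_variableChange_quadraticTwist_mul_sq d e he0
  rw [hd₁, ← hC] at hm1
  exact (hasMultiplicativeReductionAtPrime_smul_iff (W.quadraticTwist d) C q).mp hm1

/-- The case `ord_q d = 1` (`q ∥ d`, e.g. `d` a fundamental discriminant divisible by the odd prime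
`q`): `E^{(d)}` is multiplicative at `q`. [cite: SilvermanATAEC1994, V.5 Thm. 5.3] -/
theorem mult_quadraticTwist_of_addv_of_potMult_of_padicValRat_eq_one (hq2 : q ≠ 2)
    (hadd : Addv W q) (hpm : padicValRat q W.j < 0) {d : ℚ} (hd0 : d ≠ 0)
    (hd : padicValRat q d = 1) : Mult (W.quadraticTwist d) q :=
  mult_quadraticTwist_of_addv_of_potMult_of_odd hq2 hadd hpm hd0 (by rw [hd]; exact odd_one)

end OddTwist

/-! ### §2 The first lemma `RamTwistOfPotMultRamified`: the twin carries the (ram) witness `q` -/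

/-- **FIRST LEMMA of the card `ramified-twin-ram-transport` (`RamTwistOfPotMultRamified`).**  Let
`W/ℚ` be globally minimal, `q` an odd prime, `q ≠ p`, with `W` ADDITIVE and POTENTIALLY MULTIPLICATIVE
at `q` (`Addv W q`, `Additive.PotMult W q`: `ord_q j(W) < 0`), let `d ∈ ℤ` with `q ∥ d`
(`padicValInt q d = 1`), and let `Wd = Cd • W^{(d)}` be a globally minimal model of the twist.  If
`p ∤ ord_q j(W)` then: `Wd` is MULTIPLICATIVE at `q`; `ord_q Δ_min(Wd) = −ord_q j(W)`; and `Ram Wd p`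
with witness `q` (a multiplicative prime `ℓ = q ≠ p` of `Wd` with `p ∤ ord_ℓ Δ_min(Wd)`).  §1 gives
`Mult`; at a multiplicative prime of a globally minimal model `ord_q j = −ord_q Δ_min`
(Silverman *AEC* VII.5.1(b); tree `AdditivePotMult.padicValRat_j_eq_neg_of_mult`), and
`j(Wd) = j(W)` (`AdditivePotMult.j_of_model_twist`).  (Tate: an odd additive `q` with `ord_q j < 0`
is `I_m^*`, `m = −ord_q j`, and any `d` with `q ∥ d` untwists it to `I_m`.)
[cite: SilvermanATAEC1994, V.5 Thm. 5.3 and IV.9 Table 4.1] [cite: SilvermanAEC2009, VII.5 Prop. 5.1(b)]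
[cite: SkinnerUrban2014, Thm. 2 (p. 3), second bullet] -/
theorem ramTwist_of_addv_of_potMult (W : WeierstrassCurve ℚ) [W.IsElliptic] [W.IsGloballyMinimal]
    (p q : ℕ) [Fact p.Prime] [Fact q.Prime] (d : ℤ) (Wd : WeierstrassCurve ℚ) [Wd.IsElliptic]
    [Wd.IsGloballyMinimal] (Cd : VariableChange ℚ) (hq2 : q ≠ 2) (hqp : q ≠ p) (hadd : Addv W q)
    (hpm : Additive.PotMult W q) (hd : padicValInt q d = 1)
    (hWd : Cd • W.quadraticTwist (d : ℚ) = Wd) (hndvd : ¬ (p : ℤ) ∣ padicValRat q W.j) :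
    Mult Wd q ∧ padicValInt q Wd.minimalDiscriminantInt = - padicValRat q W.j ∧ Ram Wd p := by
  have hdz : d ≠ 0 := by
    rintro rfl
    simp at hd
  have hd0 : (d : ℚ) ≠ 0 := by exact_mod_cast hdz
  have hdv : padicValRat q (d : ℚ) = 1 := by
    rw [padicValRat.of_int]
    exact_mod_cast hd
  have hmtw : Mult (W.quadraticTwist (d : ℚ)) q :=
    mult_quadraticTwist_of_addv_of_potMult_of_padicValRat_eq_one hq2 hadd hpm hd0 hdv
  have hmult : Mult Wd q := AdditivePotMult.mult_of_model_twist hd0 hmtw ⟨Cd, hWd⟩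
  have hj : Wd.j = W.j := AdditivePotMult.j_of_model_twist hd0 ⟨Cd, hWd⟩
  have hval : (padicValInt q Wd.minimalDiscriminantInt : ℤ) = - padicValRat q W.j := by
    rw [← hj, AdditivePotMult.padicValRat_j_eq_neg_of_mult Wd q hmult, neg_neg]
  refine ⟨hmult, hval, q, ‹Fact q.Prime›, hqp, hmult, ?_⟩
  rw [AdditivePotMult.dvd_padicValInt_minimalDiscriminantInt_iff_of_mult Wd q hmult p, hj]
  exact hndvd

/-- `RamTwistOfPotMultRamified` in the `∀`-form of the card's Sketch.lean (its `def … : Prop` body,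
verbatim): the statement a registered line would cite.
[cite: SilvermanATAEC1994, V.5 Thm. 5.3] [cite: SilvermanAEC2009, VII.5 Prop. 5.1(b)] -/
theorem ramTwistOfPotMultRamified :
    ∀ (W : WeierstrassCurve ℚ) [W.IsElliptic] [W.IsGloballyMinimal] (p q : ℕ) [Fact p.Prime]
      [Fact q.Prime] (d : ℤ) (Wd : WeierstrassCurve ℚ) [Wd.IsElliptic] [Wd.IsGloballyMinimal]
      (Cd : WeierstrassCurve.VariableChange ℚ),
      q ≠ 2 → q ≠ p → Addv W q → Additive.PotMult W q → padicValInt q d = 1 →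
      Cd • W.quadraticTwist (d : ℚ) = Wd → ¬ (p : ℤ) ∣ padicValRat q W.j →
      Mult Wd q ∧ padicValInt q Wd.minimalDiscriminantInt = - padicValRat q W.j ∧ Ram Wd p :=
  fun W _ _ p q _ _ d Wd _ _ Cd ↦ ramTwist_of_addv_of_potMult W p q d Wd Cd

/-! ### §3 The twin's lower half on the served class is Skinner 2016 Thm. C (`TwinLowerOfSkinnerC`) -/

/-- **`TwinLowerOfSkinnerC` (card `ramified-twin-ram-transport`, Sketch.lean): the twin's `≥`-half is a
THEOREM-SHAPE, not `X11aLowerHalf`.**  CONDITIONAL on the named fact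
`Skinner2016.thmC_padicValRat_bsd_rank_zero` (Skinner 2016 Thm. C, taken as the hypothesis `hSk`).
For `W` globally minimal, `p ≥ 5`, `q ≠ 2`, `q ≠ p`, `Irr W p`, `W` additive and potentially
multiplicative at `q`, `d ∈ ℤ` with `q ∥ d`, `Wd = Cd • W^{(d)}` globally minimal, `p ∤ ord_q j(W)`,
`Wd` multiplicative at `p`, `L(Wd, 1) ≠ 0`, `Ш(Wd)` finite: the `p`-part of the rank-`0` BSD formula
for `Wd` in Skinner's currency.  Skinner's hypotheses: `3 ≤ p`; multiplicative at `p` (given); `Irr Wd p`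
(`AdditivePotMult.irr_iff_of_model_twist`); (ram) with witness `q` (§2); `L ≠ 0`, `Ш` finite (given).
[cite: Skinner2016PacificMC, Thm. C (§1)] [cite: SilvermanATAEC1994, V.5 Thm. 5.3] -/
theorem twinLower_of_thmC (hSk : Skinner2016.thmC_padicValRat_bsd_rank_zero)
    (W : WeierstrassCurve ℚ) [W.IsElliptic] [W.IsGloballyMinimal] (p q : ℕ) [Fact p.Prime]
    [Fact q.Prime] (d : ℤ) (Wd : WeierstrassCurve ℚ) [Wd.IsElliptic] [Wd.IsGloballyMinimal]
    (Cd : VariableChange ℚ) (hp5 : 5 ≤ p) (hq2 : q ≠ 2) (hqp : q ≠ p) (hirr : Irr W p)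
    (hadd : Addv W q) (hpm : Additive.PotMult W q) (hd : padicValInt q d = 1)
    (hWd : Cd • W.quadraticTwist (d : ℚ) = Wd) (hndvd : ¬ (p : ℤ) ∣ padicValRat q W.j)
    (hmultp : Mult Wd p) (hL : Wd.entireLFunction 1 ≠ 0) (hfin : Finite Wd.sha) :
    ∃ r : ℚ, Wd.entireLFunction 1 / (Wd.realPeriodRat : ℂ) = (r : ℂ) ∧
      padicValRat p r = (padicValNat p Wd.shaOrder : ℤ) + padicValNat p Wd.tamagawaProduct -
        2 * padicValNat p Wd.torsionOrder := by
  have hdz : d ≠ 0 := by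
    rintro rfl
    simp at hd
  have hd0 : (d : ℚ) ≠ 0 := by exact_mod_cast hdz
  obtain ⟨-, -, hram⟩ := ramTwist_of_addv_of_potMult W p q d Wd Cd hq2 hqp hadd hpm hd hWd hndvd
  have hirr' : Irr Wd p := (AdditivePotMult.irr_iff_of_model_twist hd0 ⟨Cd, hWd⟩).mpr hirr
  exact hSk Wd p (by omega) (Or.inr hmultp) hirr' hram hL hfin

/-- `TwinLowerOfSkinnerC` in the `∀`-form of the card's Sketch.lean (its `def … : Prop` body with the
now-proved first lemma `RamTwistOfPotMultRamified` no longer a hypothesis): Skinner 2016 Thm. C ⟹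
the twin's lower half on the served class. [cite: Skinner2016PacificMC, Thm. C (§1)] -/
theorem twinLowerOfSkinnerC_of_thmC :
    Skinner2016.thmC_padicValRat_bsd_rank_zero →
    ∀ (W : WeierstrassCurve ℚ) [W.IsElliptic] [W.IsGloballyMinimal] (p q : ℕ) [Fact p.Prime]
      [Fact q.Prime] (d : ℤ) (Wd : WeierstrassCurve ℚ) [Wd.IsElliptic] [Wd.IsGloballyMinimal]
      (Cd : WeierstrassCurve.VariableChange ℚ),
      5 ≤ p → q ≠ 2 → q ≠ p → Irr W p → Addv W q → Additive.PotMult W q → padicValInt q d = 1 →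
      Cd • W.quadraticTwist (d : ℚ) = Wd → ¬ (p : ℤ) ∣ padicValRat q W.j → Mult Wd p →
      Wd.entireLFunction 1 ≠ 0 → Finite Wd.sha →
      ∃ r : ℚ, Wd.entireLFunction 1 / (Wd.realPeriodRat : ℂ) = (r : ℂ) ∧
        padicValRat p r = (padicValNat p Wd.shaOrder : ℤ) + padicValNat p Wd.tamagawaProduct -
          2 * padicValNat p Wd.torsionOrder :=
  fun hSk W _ _ p q _ _ d Wd _ _ Cd ↦ twinLower_of_thmC hSk W p q d Wd Cd

end Summit.BirchSwinnertonDyer.BirchSwinnertonDyer.Theorems.EulerHalfRamTwist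

end
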